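import Summits.QuantumFields.YangMills.Theorems.BalabanUVNodesN12DatumLetterOfShadows
import Summits.QuantumFields.YangMills.Theorems.BalabanUVNodesN11LocalIteratedAveraging
import HarnessLib

/-!
# BalabanUVNodes ∕ N12 — THE PLAQUETTE LETTER ON THE ITERATED AVERAGES IS THE CLASS PLUS GEOMETRY: for a member bond `c` of level `i`, the plaquettes of `M^j(U₀)` (`j < i`) around the bonds of
# its segment are `2·εreg·L²`-small, by [Balaban1985Averaging] Prop. 2 LOCAL and uniform in the number of averagings (dag-n11's `…N11LocalIteratedAveraging`) applied `i − 1` times from the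
# class (1.7) of the minimiser two levels down (`εreg·η_{i−2}² = (εreg·L²)·η_{i−1}²`) — modulo a DISPLAYED box-closed family of plaquette sets per member (pure geometry) and the smallness of `εreg`

Cell `pub-ymgap` (HUMAN RULINGS D-0062 ∕ D-0149), WIDTH SEAT `pub-ymgap-dag-n12-w3` g4 (node N12 = [B15]; key K1⁹ `stmt-QuantumFields-27364` (KEY MAP v2), `--kind proof --supports … --as
helper`; count-neutral).  THEOREMS ONLY (0 `def`, 0 `instance`, 0 `sorry`); consumed BY NAME: dag-n11's `BalabanUVNodesN11LocalIteratedAveraging.plaqSmallOn_iter_avOfRecord_of_boxClosed` ((52) ⇒ (53) local,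
`k`-uniform, at the averaging of record), NODE 00's class of record `Node00.regMSCoPOfRecord` ([15] (2) ∕ [6] (1.7) per level on `topSeq Ω₀ Ω`), this lineage's
`N12DatumLetterOfShadows.exists_gaugeLetterLoc_atRecord_of_class_of_shadows`.

WHY.  After `…OfClass` ∕ `…DatumLetterOfShadows` the (σ)_N capstone displays ONE estimate that is not a class membership, a datum bound or geometry: the plaquette letter `a_j` on the ITERATED
AVERAGES `M^j(U₀)` in the three blocks around every level-`(j+1)` bond of a member segment (dag-n12-w2's currency, feeding `dist1_corr_le_local`).  Print controls the averages of a regular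
configuration by [Balaban1985Averaging] Prop. 2 ((52) ⇒ (53)); the tree has it LOCAL and `k`-UNIFORM (dag-n11): a box-closed family `S` of plaquette sets down the tower with `|U(∂p) − 1| < α₀η²` on
`S 0` only gives `|M^j U(∂p′) − 1| < 2α₀(L^jη)²` on `S j`.  For a member of level `i` the segment lives in `Ω_{i−1}` and its averaging footprint in `Ω_{i−2}`, where the class gives
`εreg·η_{i−2}²`; with `i − 1` averagings (`η = η_{i−1}`) this is `α₀ = εreg·L²`, and (53) at `j ≤ i − 1` gives `< 2·εreg·L²` — a CONSTANT bound `a`.  THIS FILE: ★★ `iteratedPlaqLetter_of_family` —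
the letter `ha` of the capstones with `a := 2·εreg·L²`, from the class (`hmin.1`) and a DISPLAYED per-member family `Sfam i c` (box-closed below level `i − 1`, `Sfam i c 0 ⊆ plaqsOf (topSeq Ω₀ Ω (i−2))`,
containing the three-block plaquettes of the segment — lattice geometry, the next file of this lineage) under the smallness of `εreg` (Prop. 2's `C₀α₀ ≤ ⅓`, `2α₀ ≤ c′₂`); ★★★
`exists_gaugeLetterLoc_atRecord_of_class_of_family` — the (σ)_N capstone with `ha` so discharged: RESIDUE = the minimiser in NODE 00's class, the region datum `W 𝒞 ρn`, the GEOMETRY letters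
(`hGN`, `hN1`, `hGmem`, `Sfam`), the tower budgets `θ` (`6·(((d+2)L)²∕4)·a + L·θ_j ≤ θ_{j+1}`), and NUMERICS (`εreg` small and positive, no-wrap, radii, `2 ≤ M₁`, cover divisibility).
SCALING (honest): `a` constant and `θ_k ∼ a·L^k` make `eT = m·θ_k` as crude as the scale-0 Stokes term; print's per-level tolerances need the graded producer (cell bus 2026-08-28, lane word «keep both»).

HONEST FRAMING.  Composition by name; the minimiser ([15] Thm 1 ∕ (E)), the region datum, the geometry letters, the budgets and the numerics stay HYPOTHESES; nothing of Bałaban's asserted beyond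
the cited tree theorems; count-neutral; N12 NOT discharged; K1⁹ NOT closed; counts unmoved (typed 28∕28 · discharged 5∕27); one finite 𝕋⁴ programme at fixed ε — R4 closes the conditional rung
`BalabanLadder.UV` only; the Yang–Mills mass gap (Clay) is NOT proved by any of this; nothing continuum ∕ ℝ⁴ ∕ OS.
-/

noncomputable section

open scoped Matrix.Norms.L2Operator BigOperators

namespace Summit.QuantumFields.YangMills.BalabanUVNodes.N12IteratedPlaqLetterOfFamily

open Literature.MathematicalPhysics.QuantumFieldTheory.Balaban1983to89
open T4Continuum GaugeField B15DeterminingSets BlockAveraging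
open T4CubeChartGnomonic (SU2)
open B16Sect1Backgrounds (toMS)
open T4AxialGaugeSmallField (boxPlaqs)
open B14.Eq213MaximalDomains (side)
open B14.Eq213DetSet (Bj maxDomT)
open B14.Eq216Concrete (inputs)
open B14.Eq22Determines (blockIter)
open B5Eq118OneStroke (iterBlockOf)
open B8Eq17ClassAkV1 (plaqsOf)
open ExpMeanLog (deltaSU)
open Literature.MathematicalPhysics.QuantumFieldTheory.BalabanImbrieJaffe1984to88.BIJ85Eq453GaugeField (qsstarGIter0)
open Summit.QuantumFields.YangMills.BalabanUVNodes.N20LCSAvgDominationRegion (boxRegion)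
open Summit.QuantumFields.YangMills.Theorems.BalabanUVNodesN11LocalIteratedAveraging (plaqSmallOn_iter_avOfRecord_of_boxClosed)
open Summit.QuantumFields.YangMills.BalabanUVNodes.N12DatumLetterOfShadows (exists_gaugeLetterLoc_atRecord_of_class_of_shadows)

variable {P : Params}

/-! ## §1 The plaquette letter on the iterated averages from the class and a box-closed family -/

/-- ★★ **THE ITERATED-AVERAGE PLAQUETTE LETTER FROM THE CLASS AND A BOX-CLOSED FAMILY.**  `U₀` in NODE 00's class of record at `𝐁_k(Z)` ([15] (2) ∕ (1.7) on `topSeq Ω₀ Ω j`, `j ≤ k`),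
`εreg > 0` small (`143·((d+4)²∕4)²·(εreg·L²) ≤ ⅓`, `2·εreg·L² ≤ 2δ_{SU(2)}∕((d+4)L)²`); DISPLAYED GEOMETRY: for every member bond `c` of level `i ≤ k` a family `Sfam i c j` of level-`j` plaquette sets,
box-closed downward below `i − 1` (dag-n11's premise, radius `(d+4)L+2`), with `Sfam i c 0 ⊆ plaqsOf (topSeq Ω₀ Ω (i−2))` and containing the level-`j` plaquettes of the three blocks around every
level-`(j+1)` bond of the segment of `c` (`j < i`).  THEN those plaquettes of `M^j(U₀)` are `2·εreg·L²`-small — the letter `ha` of the (σ)_N capstones with `a := 2·εreg·L²`.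
[cite: Balaban1985Averaging, Prop. 2 (52)–(53) p.26; Balaban1985RegularSpaces, (1.7) p.77; Balaban1985Variational, (2) p.278; Balaban1988Convergent, (2.13) pp.256–257, (2.16) p.257] -/
theorem iteratedPlaqLetter_of_family {F : T4Family} (ν : Node00.Stage7Numerics) (Kt : ℕ) {k : ℕ} (Z : Set (Site (F.P Kt) 0))
    {U₀ : GaugeField (F.P Kt) 0 SU2} (hclass : U₀ ∈ Node00.regMSCoPOfRecord F 2 ν Kt k (maxDomT ν.M₁ Z))
    (hεpos : 0 < ν.εreg)
    (hα3 : (143 * (((((F.P Kt).d + 4 : ℕ) : ℝ)) ^ 2 / 4) ^ 2) * (ν.εreg * (F.P Kt).L ^ 2) ≤ 1 / 3)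
    (hα2 : 2 * (ν.εreg * (F.P Kt).L ^ 2) ≤ 2 * deltaSU (Fin 2) / ((((F.P Kt).d + 4) * (F.P Kt).L : ℕ) : ℝ) ^ 2)
    (Sfam : (i : ℕ) → PBond (F.P Kt) i → (j : ℕ) → Set (Plaq (F.P Kt) j))
    (hSclosed : ∀ i, 1 ≤ i → i ≤ k → ∀ c ∈ bondsOf ((Bj ν.M₁ Z k : DetSet (F.P Kt)) i), ∀ j, j < i - 1 → ∀ p ∈ Sfam i c (j + 1),
      (↑(boxRegion (emb p.src) (((F.P Kt).d + 4) * (F.P Kt).L + 2)) : Set (Plaq (F.P Kt) j)) ⊆ Sfam i c j)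
    (hSbase : ∀ i, 1 ≤ i → i ≤ k → ∀ c ∈ bondsOf ((Bj ν.M₁ Z k : DetSet (F.P Kt)) i),
      Sfam i c 0 ⊆ plaqsOf (Node00.topSeq (Node00.suppDomOfRecord F ν Kt (maxDomT ν.M₁ Z)) (maxDomT ν.M₁ Z) (i - 2)))
    (hSneed : ∀ i, 1 ≤ i → i ≤ k → ∀ c ∈ bondsOf ((Bj ν.M₁ Z k : DetSet (F.P Kt)) i), ∀ j < i, ∀ c' : PBond (F.P Kt) (j + 1), c'.dir = c.dir →
      (∃ s < (F.P Kt).L ^ i, embIter (j + 1) c'.src = (fun z : Site (F.P Kt) 0 => z.shift c.dir)^[s] (embIter i c.src)) →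
      ∀ q : Plaq (F.P Kt) j, (blockOf q.src = c'.src.unshift c'.dir ∨ blockOf q.src = c'.src ∨ blockOf q.src = c'.tgt) → q ∈ Sfam i c j) :
    ∀ i ≤ k, ∀ c ∈ bondsOf ((Bj ν.M₁ Z k : DetSet (F.P Kt)) i), ∀ j < i, ∀ c' : PBond (F.P Kt) (j + 1), c'.dir = c.dir →
      (∃ s < (F.P Kt).L ^ i, embIter (j + 1) c'.src = (fun z : Site (F.P Kt) 0 => z.shift c.dir)^[s] (embIter i c.src)) →
      ∀ q : Plaq (F.P Kt) j, (blockOf q.src = c'.src.unshift c'.dir ∨ blockOf q.src = c'.src ∨ blockOf q.src = c'.tgt) →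
        dist1 (GaugeField.plaqHol (avgFamily (Node00.avOfRecord F 2 Kt) U₀ j) q) < 2 * (ν.εreg * (F.P Kt).L ^ 2) := by
  intro i hi c hc j hj c' hdir hs q hq
  have hi1 : 1 ≤ i := by omega
  have hq' : q ∈ Sfam i c j := hSneed i hi1 hi c hc j hj c' hdir hs q hq
  have hL1 : (1 : ℝ) ≤ (F.P Kt).L := by exact_mod_cast (F.P Kt).L_pos
  have hL0 : (0 : ℝ) < (F.P Kt).L := by linarith
  -- the class two levels down, restricted to the base of the family, at the tolerance `(εreg·L²)·η_{i−1}²`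
  have hcl := ((Node00.mem_regMSCoPOfRecord_iff F 2 ν Kt k (maxDomT ν.M₁ Z) U₀).1 hclass).1 (i - 2) (by omega)
  have heta : ν.εreg * (F.P Kt).eta (i - 2) ^ 2 ≤ ν.εreg * (F.P Kt).L ^ 2 * (F.P Kt).eta (i - 1) ^ 2 := by
    rcases Nat.lt_or_ge i 2 with h2 | h2
    · -- `i ≤ 1`: both exponents are `0`
      have e1 : i - 2 = 0 := by omega
      have e2 : i - 1 = 0 := by omega
      rw [e1, e2]
      simp only [Params.eta, pow_zero, one_pow, mul_one]
      have hL2 : (1 : ℝ) ≤ ((F.P Kt).L : ℝ) ^ 2 := one_le_pow₀ hL1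
      nlinarith [mul_le_mul_of_nonneg_left hL2 hεpos.le]
    · -- `i ≥ 2`: `η_{i−2} = L·η_{i−1}`
      have e : (F.P Kt).eta (i - 2) = (F.P Kt).L * (F.P Kt).eta (i - 1) := by
        have hsucc : i - 1 = (i - 2) + 1 := by omega
        rw [hsucc]
        unfold Params.eta
        rw [pow_succ]
        field_simp
      rw [e]; ring_nf; exact le_rfl
  have h52 : PlaqSmallOn (Sfam i c 0) (ν.εreg * (F.P Kt).L ^ 2 * (F.P Kt).eta (i - 1) ^ 2) U₀ :=
    fun p hp => (hcl p (hSbase i hi1 hi c hc hp)).trans_le heta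
  have h53 := plaqSmallOn_iter_avOfRecord_of_boxClosed F 2 Kt (i - 1) (Sfam i c) (fun l hl p hp => hSclosed i hi1 hi c hc l hl p hp)
    (α₀ := ν.εreg * (F.P Kt).L ^ 2) (by positivity) hα3 hα2 h52 (j := j) (by omega)
  have hq53 := h53 q hq'
  -- `(L^j·η_{i−1})² ≤ 1` for `j ≤ i − 1`
  have hratio : (((F.P Kt).L : ℝ) ^ j * (F.P Kt).eta (i - 1)) ^ 2 ≤ 1 := by
    have h1 : ((F.P Kt).L : ℝ) ^ j * (F.P Kt).eta (i - 1) ≤ 1 := by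
      unfold Params.eta
      rw [inv_pow, ← div_eq_mul_inv, div_le_one (pow_pos hL0 _)]
      exact pow_le_pow_right₀ hL1 (by omega)
    have h0 : 0 ≤ ((F.P Kt).L : ℝ) ^ j * (F.P Kt).eta (i - 1) := by unfold Params.eta; positivity
    nlinarith
  have hα0 : 0 ≤ 2 * (ν.εreg * (F.P Kt).L ^ 2) := by positivity
  calc dist1 (GaugeField.plaqHol (avgFamily (Node00.avOfRecord F 2 Kt) U₀ j) q)
      < 2 * (ν.εreg * (F.P Kt).L ^ 2) * (((F.P Kt).L : ℝ) ^ j * (F.P Kt).eta (i - 1)) ^ 2 := hq53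
    _ ≤ 2 * (ν.εreg * (F.P Kt).L ^ 2) := by nlinarith

/-! ## §2 The (σ)_N capstone with the iterated-average plaquette letter so discharged -/

/-- ★★★ **(σ)_N AT THE RECORD FROM THE CLASS, THE SHADOW GEOMETRY AND A BOX-CLOSED FAMILY.**  As `N12DatumLetterOfShadows.exists_gaugeLetterLoc_atRecord_of_class_of_shadows` with the plaquette letter
on the iterated averages discharged by `iteratedPlaqLetter_of_family` at the constant bound `a := 2·εreg·L²`.  RESIDUE (all class ∕ datum ∕ geometry ∕ numerics): the minimiser in NODE 00's class, the region
datum `W 𝒞 ρn`, the `N`-geometry `hGN`∕`hN1`, the shadow geometry `hGmem`, the per-member box-closed family `Sfam`, the tower budgets `θ`, `εreg` positive and small, no wrapping, radii, `2 ≤ M₁`, cover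
divisibility.  Conclusion: the (σ)_N letter of record with tolerance `max ρn (((2ℓ_k+1+m·L^k)²∕4)·(εreg·η₀²) + m·θ_k + m·ρn)`.
[cite: Balaban1985Variational, (2)–(4) p.278, (16)–(18) p.280; Balaban1985RegularSpaces, (1.7) p.77, (1.19) p.79; Balaban1985Averaging, Prop. 2 (52)–(53) p.26; Balaban1988Convergent, (2.12)–(2.13) pp.256–257, (2.16) p.257] -/
theorem exists_gaugeLetterLoc_atRecord_of_class_of_family {F : T4Family} (ν : Node00.Stage7Numerics) (Kt : ℕ) {k : ℕ} (hk0 : 0 < k) (hk : k ≤ (F.P Kt).m + (F.P Kt).K)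
    (hM2 : 2 ≤ ν.M₁) (hdiv : side (F.P Kt).L ν.M₁ k ∣ (F.P Kt).sitesPerDir 0) (Z : Set (Site (F.P Kt) 0))
    -- no wrapping, at the caps `ℓ_k`, `m·L^k`
    (hN : 2 * (∑ i ∈ Finset.range (k + 1), ((F.P Kt).d * (((F.P Kt).L ^ i - 1) / 2) + 1)) + 1 +
      (3 * ((F.P Kt).d * (((F.P Kt).L - 1) / 2)) + 5) * (F.P Kt).L ^ k < (F.P Kt).sitesPerDir 0)
    -- radius numerics: the level-`J` box fits the collar `L^{J−1}·M₁`
    (hRad : ∀ J, 1 ≤ J → J ≤ k →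
      (2 * ∑ i ∈ Finset.range (J + 1 + 1), ((F.P Kt).d * (((F.P Kt).L ^ i - 1) / 2) + 1)) + 1 +
          (3 * ((F.P Kt).d * (((F.P Kt).L - 1) / 2)) + 5) * (F.P Kt).L ^ min (J + 1) k +
        (∑ i ∈ Finset.range (J + 1), ((F.P Kt).d * (((F.P Kt).L ^ i - 1) / 2) + 1)) + 3 ≤ (F.P Kt).L ^ (J - 1) * ν.M₁)
    -- the region-normalised datum and the minimiser
    {ρn : ℝ} (hρn : 0 ≤ ρn)
    (W : GaugeField (F.P Kt) k SU2) (𝒞 : Set (PBond (F.P Kt) k)) (hD : ∀ c ∈ 𝒞, dist1 (W c) ≤ ρn)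
    {U₀ : GaugeField (F.P Kt) 0 SU2}
    (hmin : IsMinimizer (Node00.avOfRecord F 2 Kt) (Node00.regMSCoPOfRecord F 2 ν Kt k (maxDomT ν.M₁ Z)) (Bj ν.M₁ Z k)
      (avgFamily (Node00.avOfRecord F 2 Kt) (qsstarGIter0 k W)) U₀)
    -- geometry of the neighbourhood (dag-n12-w6's letters, verbatim)
    (N : Set (PBond (F.P Kt) 0))
    (hGN : ∀ b ∈ N, (b.src ∉ maxDomT ν.M₁ Z 1 ∨ b.tgt ∉ maxDomT ν.M₁ Z 1) → blockIter k b.tgt ≠ blockIter k b.src →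
      (⟨blockIter k b.src, b.dir⟩ : PBond (F.P Kt) k) ∈ 𝒞)
    (hN1 : ∀ p : Plaq (F.P Kt) 0, ((⟨p.src, p.μ⟩ : PBond (F.P Kt) 0) ∈ {b : PBond (F.P Kt) 0 | b.src ∈ maxDomT ν.M₁ Z 1} ∨
        (⟨p.src.shift p.μ, p.ν⟩ : PBond (F.P Kt) 0) ∈ {b : PBond (F.P Kt) 0 | b.src ∈ maxDomT ν.M₁ Z 1} ∨
        (⟨p.src.shift p.ν, p.μ⟩ : PBond (F.P Kt) 0) ∈ {b : PBond (F.P Kt) 0 | b.src ∈ maxDomT ν.M₁ Z 1} ∨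
        (⟨p.src, p.ν⟩ : PBond (F.P Kt) 0) ∈ {b : PBond (F.P Kt) 0 | b.src ∈ maxDomT ν.M₁ Z 1}) →
      (⟨p.src, p.μ⟩ : PBond (F.P Kt) 0) ∈ N ∧ (⟨p.src.shift p.μ, p.ν⟩ : PBond (F.P Kt) 0) ∈ N ∧
        (⟨p.src.shift p.ν, p.μ⟩ : PBond (F.P Kt) 0) ∈ N ∧ (⟨p.src, p.ν⟩ : PBond (F.P Kt) 0) ∈ N)
    -- the class threshold `εreg`: positive and small ([Balaban1985Averaging] Prop. 2's smallness at `α₀ := εreg·L²`)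
    (hεpos : 0 < ν.εreg)
    (hα3 : (143 * (((((F.P Kt).d + 4 : ℕ) : ℝ)) ^ 2 / 4) ^ 2) * (ν.εreg * (F.P Kt).L ^ 2) ≤ 1 / 3)
    (hα2 : 2 * (ν.εreg * (F.P Kt).L ^ 2) ≤ 2 * deltaSU (Fin 2) / ((((F.P Kt).d + 4) * (F.P Kt).L : ℕ) : ℝ) ^ 2)
    (haN : (((((F.P Kt).d + 2) * (F.P Kt).L : ℕ) : ℝ) ^ 2 / 4) * (2 * (ν.εreg * (F.P Kt).L ^ 2)) < deltaSU (Fin 2))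
    -- the tower budgets `θ` fed by the constant plaquette bound `a := 2·εreg·L²`
    (θ : ℕ → ℝ) (hθ0 : 0 ≤ θ 0)
    (hθ : ∀ j, 6 * ((((((F.P Kt).d + 2) * (F.P Kt).L : ℕ) : ℝ) ^ 2 / 4) * (2 * (ν.εreg * (F.P Kt).L ^ 2))) + (F.P Kt).L * θ j ≤ θ (j + 1))
    -- DISPLAYED GEOMETRY: per member bond a box-closed family of plaquette sets down the tower, based in the class region two levels down, containing the three-block plaquettes of its segment
    (Sfam : (i : ℕ) → PBond (F.P Kt) i → (j : ℕ) → Set (Plaq (F.P Kt) j))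
    (hSclosed : ∀ i, 1 ≤ i → i ≤ k → ∀ c ∈ bondsOf ((Bj ν.M₁ Z k : DetSet (F.P Kt)) i), ∀ j, j < i - 1 → ∀ p ∈ Sfam i c (j + 1),
      (↑(boxRegion (emb p.src) (((F.P Kt).d + 4) * (F.P Kt).L + 2)) : Set (Plaq (F.P Kt) j)) ⊆ Sfam i c j)
    (hSbase : ∀ i, 1 ≤ i → i ≤ k → ∀ c ∈ bondsOf ((Bj ν.M₁ Z k : DetSet (F.P Kt)) i),
      Sfam i c 0 ⊆ plaqsOf (Node00.topSeq (Node00.suppDomOfRecord F ν Kt (maxDomT ν.M₁ Z)) (maxDomT ν.M₁ Z) (i - 2)))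
    (hSneed : ∀ i, 1 ≤ i → i ≤ k → ∀ c ∈ bondsOf ((Bj ν.M₁ Z k : DetSet (F.P Kt)) i), ∀ j < i, ∀ c' : PBond (F.P Kt) (j + 1), c'.dir = c.dir →
      (∃ s < (F.P Kt).L ^ i, embIter (j + 1) c'.src = (fun z : Site (F.P Kt) 0 => z.shift c.dir)^[s] (embIter i c.src)) →
      ∀ q : Plaq (F.P Kt) j, (blockOf q.src = c'.src.unshift c'.dir ∨ blockOf q.src = c'.src ∨ blockOf q.src = c'.tgt) → q ∈ Sfam i c j)
    -- GEOMETRY instead of the datum letter: the `k`-shadows of the face-crossing members of `𝐁_k(Z)` lie in `𝒞`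
    (hGmem : ∀ i ≤ k, ∀ c ∈ bondsOf ((Bj ν.M₁ Z k : DetSet (F.P Kt)) i), blockIter k (embIter i c.tgt) ≠ blockIter k (embIter i c.src) →
      (⟨blockIter k (embIter i c.src), c.dir⟩ : PBond (F.P Kt) k) ∈ 𝒞) :
    ∃ σ : GaugeTransf (F.P Kt) 0 SU2,
      (∀ j, j ≤ k → ∀ b ∈ bondsOf (Bj ν.M₁ Z k j), toMS σ j b.src = 1 ∧ toMS σ j b.tgt = 1) ∧
        (∀ p : Plaq (F.P Kt) 0, ((⟨p.src, p.μ⟩ : PBond (F.P Kt) 0) ∈ {b : PBond (F.P Kt) 0 | b.src ∈ maxDomT ν.M₁ Z 1} ∨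
            (⟨p.src.shift p.μ, p.ν⟩ : PBond (F.P Kt) 0) ∈ {b : PBond (F.P Kt) 0 | b.src ∈ maxDomT ν.M₁ Z 1} ∨
            (⟨p.src.shift p.ν, p.μ⟩ : PBond (F.P Kt) 0) ∈ {b : PBond (F.P Kt) 0 | b.src ∈ maxDomT ν.M₁ Z 1} ∨
            (⟨p.src, p.ν⟩ : PBond (F.P Kt) 0) ∈ {b : PBond (F.P Kt) 0 | b.src ∈ maxDomT ν.M₁ Z 1}) →
          ‖((gaugeAct σ U₀ ⟨p.src, p.μ⟩ : SU2) : Matrix (Fin 2) (Fin 2) ℂ) - 1‖ ≤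
              max ρn ((((2 * (∑ i ∈ Finset.range (k + 1), ((F.P Kt).d * (((F.P Kt).L ^ i - 1) / 2) + 1)) + 1 +
                  (3 * ((F.P Kt).d * (((F.P Kt).L - 1) / 2)) + 5) * (F.P Kt).L ^ k : ℕ) : ℝ)) ^ 2 / 4 * (ν.εreg * (F.P Kt).eta 0 ^ 2) +
                ((3 * ((F.P Kt).d * (((F.P Kt).L - 1) / 2)) + 5 : ℕ) : ℝ) * θ k + ((3 * ((F.P Kt).d * (((F.P Kt).L - 1) / 2)) + 5 : ℕ) : ℝ) * ρn) ∧
            ‖((gaugeAct σ U₀ ⟨p.src.shift p.μ, p.ν⟩ : SU2) : Matrix (Fin 2) (Fin 2) ℂ) - 1‖ ≤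
              max ρn ((((2 * (∑ i ∈ Finset.range (k + 1), ((F.P Kt).d * (((F.P Kt).L ^ i - 1) / 2) + 1)) + 1 +
                  (3 * ((F.P Kt).d * (((F.P Kt).L - 1) / 2)) + 5) * (F.P Kt).L ^ k : ℕ) : ℝ)) ^ 2 / 4 * (ν.εreg * (F.P Kt).eta 0 ^ 2) +
                ((3 * ((F.P Kt).d * (((F.P Kt).L - 1) / 2)) + 5 : ℕ) : ℝ) * θ k + ((3 * ((F.P Kt).d * (((F.P Kt).L - 1) / 2)) + 5 : ℕ) : ℝ) * ρn) ∧
            ‖((gaugeAct σ U₀ ⟨p.src.shift p.ν, p.μ⟩ : SU2) : Matrix (Fin 2) (Fin 2) ℂ) - 1‖ ≤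
              max ρn ((((2 * (∑ i ∈ Finset.range (k + 1), ((F.P Kt).d * (((F.P Kt).L ^ i - 1) / 2) + 1)) + 1 +
                  (3 * ((F.P Kt).d * (((F.P Kt).L - 1) / 2)) + 5) * (F.P Kt).L ^ k : ℕ) : ℝ)) ^ 2 / 4 * (ν.εreg * (F.P Kt).eta 0 ^ 2) +
                ((3 * ((F.P Kt).d * (((F.P Kt).L - 1) / 2)) + 5 : ℕ) : ℝ) * θ k + ((3 * ((F.P Kt).d * (((F.P Kt).L - 1) / 2)) + 5 : ℕ) : ℝ) * ρn) ∧
            ‖((gaugeAct σ U₀ ⟨p.src, p.ν⟩ : SU2) : Matrix (Fin 2) (Fin 2) ℂ) - 1‖ ≤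
              max ρn ((((2 * (∑ i ∈ Finset.range (k + 1), ((F.P Kt).d * (((F.P Kt).L ^ i - 1) / 2) + 1)) + 1 +
                  (3 * ((F.P Kt).d * (((F.P Kt).L - 1) / 2)) + 5) * (F.P Kt).L ^ k : ℕ) : ℝ)) ^ 2 / 4 * (ν.εreg * (F.P Kt).eta 0 ^ 2) +
                ((3 * ((F.P Kt).d * (((F.P Kt).L - 1) / 2)) + 5 : ℕ) : ℝ) * θ k + ((3 * ((F.P Kt).d * (((F.P Kt).L - 1) / 2)) + 5 : ℕ) : ℝ) * ρn)) ∧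
        (∀ b ∈ inputs (Bj ν.M₁ Z k), b ∈ N →
          ‖((gaugeAct σ U₀ b : SU2) : Matrix (Fin 2) (Fin 2) ℂ) - 1‖ ≤
              max ρn ((((2 * (∑ i ∈ Finset.range (k + 1), ((F.P Kt).d * (((F.P Kt).L ^ i - 1) / 2) + 1)) + 1 +
                  (3 * ((F.P Kt).d * (((F.P Kt).L - 1) / 2)) + 5) * (F.P Kt).L ^ k : ℕ) : ℝ)) ^ 2 / 4 * (ν.εreg * (F.P Kt).eta 0 ^ 2) +
                ((3 * ((F.P Kt).d * (((F.P Kt).L - 1) / 2)) + 5 : ℕ) : ℝ) * θ k + ((3 * ((F.P Kt).d * (((F.P Kt).L - 1) / 2)) + 5 : ℕ) : ℝ) * ρn)) := by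
  refine exists_gaugeLetterLoc_atRecord_of_class_of_shadows ν Kt hk0 hk hM2 hdiv Z hεpos.le hN hRad hρn W 𝒞 hD hmin N hGN hN1
    (fun _ => 2 * (ν.εreg * (F.P Kt).L ^ 2)) θ hθ0 (fun _ => by positivity) (fun j _ => haN) hθ ?_ hGmem
  exact iteratedPlaqLetter_of_family ν Kt Z hmin.1 hεpos hα3 hα2 Sfam hSclosed hSbase hSneed

end Summit.QuantumFields.YangMills.BalabanUVNodes.N12IteratedPlaqLetterOfFamily

end
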